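import Literature.Geometry.Symplectic.SteinBallLegendrian
import Literature.Topology.FourManifolds.HandleAttachingMaps
import HarnessLib

/-!
# The model 2-handle attaching map on `B⁴` along the standard Legendrian unknot:
# its handle framing is the Seifert framing (twisting `+1`)

Topic `Literature/Geometry/Symplectic`; a proofs-only sibling of
`Topology/FourManifolds/HandleAttachingMaps.lean` (Kosinski's attaching maps `h̄ : T → M` of
`λ`-handles, `HandleAttachingMap.attachingCircle`, `HandleAttachingMap.attachingFraming`) and
`SteinBallLegendrian.lean` (the standard Legendrian unknot `legendrianUnknot : 𝕊¹ → B⁴`, its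
Seifert framing `seifertFraming = Dι⁻¹ e₁`, `twisting = +1`, `tb = -1`), checking that the whole
pipeline on which Eliashberg's theorem is stated (`SteinTwoHandles.lean`:
`Gompf1998_thm13_twoHandles`, hypotheses `IsLegendrianKnot S.J (h.attachingCircle)` and
`S.twisting h.attachingCircle h.attachingFraming = -1`) is inhabited and computes what it should
on the model.  Everything here is **proved**:

* `unknotAttachingMap : HandleAttachingMap 3 2 B⁴` — Kosinski's tube
  `T = {x ∈ D⁴ | x_λ ≠ 0}` embedded into `B⁴` by the coordinate swap `x₁ ↔ x₂` (an isometry of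
  `ℝ⁴`, restricted to the closed ball by the tree's `closedBallCongr` and to the open submanifold
  `T`; a smooth embedding with open range mapping `T ∩ ∂D⁴` into `∂B⁴`), which carries the model
  circle `S¹ × 0 = {(θ₀, θ₁, 0, 0)}` onto `{(θ₀, 0, θ₁, 0)}`:
  `attachingCircle_unknotAttachingMap : unknotAttachingMap.attachingCircle = legendrianUnknot`;
* `closedBallCoeDeriv_comp_mfderiv_unknotAttachingMap` — `Dι ∘ dh̄₀ = σ ∘ Dι` (chain rule through
  the inclusion `B⁴ ↪ ℝ⁴`, using `hasMFDerivAt_restrict_opens`: restricting to an open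
  submanifold does not change manifold derivatives — the inclusion has identity differential,
  `hasMFDerivAt_subtypeVal_opens`, a restatement of the tree's `hasMFDerivAt_subtype_val` kept
  out of the import closure, see its docstring), whence
  **`attachingFraming_unknotAttachingMap : unknotAttachingMap.attachingFraming = seifertFraming`**
  (`dh̄₀(∂/∂x_μ,₁) = Dι⁻¹(σ e₂) = Dι⁻¹ e₁`): the product framing of the model handle is the
  `0`-framing of the unknot, as in every Kirby diagram;
* consequences: the attaching circle is Legendrian for `steinStructureClosedBall`
  (`isLegendrianKnot_attachingCircle_unknotAttachingMap`), the handle framing is a knot framing,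
  and **`twisting_unknotAttachingMap = 1`**, `defect_unknotAttachingMap = 2`: this handle
  (`B⁴ ∪ h = S² × D²`, not Stein) is correctly *outside* the hypotheses of
  `Gompf1998_thm13_twoHandles` (twisting `-1`, i.e. framing `tb - 1 = -2`) and of
  `AkbulutMatveyev1998_defectZero`.  The attaching map with two left twists added (framing `-2`,
  the disc cotangent bundle of `S²`, which is Stein) is the natural inhabitant of those
  hypotheses; it is left to a sibling file.

## References

* A. A. Kosinski, *Differential Manifolds* (1993), VI §6. [Kosinski1993]
* R. E. Gompf, *Handlebody construction of Stein surfaces*, Ann. of Math. 148 (1998), §1 and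
  Thm. 1.3. [Gompf1998]
* S. Akbulut, R. Matveyev, IMRN 1998, §3 (defect). [AkbulutMatveyev1998]
-/

noncomputable section

open scoped Manifold ContDiff Topology RealInnerProductSpace
open Set Function Metric

namespace Literature.Geometry.Symplectic

open Literature.Topology.FourManifolds

/-- The model vector space `ℝ⁴` of the tangent spaces. [folklore] -/
local notation "E4" => EuclideanSpace ℝ (Fin 4)
/-- The plane `ℝ²`. [folklore] -/
local notation "E2" => EuclideanSpace ℝ (Fin 2)
/-- The closed unit 4-ball. [folklore] -/
local notation "𝔻⁴" => (Metric.closedBall (0 : EuclideanSpace ℝ (Fin 4)) 1)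
/-- Local notation: `𝕊 n` is the unit sphere in `EuclideanSpace ℝ (Fin (n + 1))`. -/
local notation "𝕊 " n:arg => (Metric.sphere (0 : EuclideanSpace ℝ (Fin (n + 1))) 1)

attribute [local instance] fact_finrank_euclideanSpace_succ

/-! ### Derivatives of restrictions to open submanifolds (domain side) -/

section Opens

variable {EM HM EN HN : Type*} [NormedAddCommGroup EM] [NormedSpace ℝ EM] [TopologicalSpace HM]
  {I : ModelWithCorners ℝ EM HM} [NormedAddCommGroup EN] [NormedSpace ℝ EN] [TopologicalSpace HN]
  {I' : ModelWithCorners ℝ EN HN} {M : Type*} [TopologicalSpace M] [ChartedSpace HM M]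
  {N : Type*} [TopologicalSpace N] [ChartedSpace HN N]

/-- **The inclusion of an open submanifold has identity differential** (the chart of `U` at `x`
is the restricted chart of `M` at `↑x`, so the inclusion reads as the identity near the base
point; Lee, *Introduction to Smooth Manifolds* (2013), Prop. 3.9: `T_xU = T_xM`).  refactor: this
is the tree's `Literature.Topology.FourManifolds.hasMFDerivAt_subtype_val`
(`OrientedConnectedSumSphereSelf.lean`; also re-derived as
`Literature.Geometry.Lorentzian.hasMFDerivAt_subtypeVal`, `HypersurfaceRestriction.lean`),
restated here to keep connected-sum theory out of the import closure of the Stein files.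
[folklore] -/
theorem hasMFDerivAt_subtypeVal_opens (U : TopologicalSpace.Opens M) (x : U) :
    HasMFDerivAt I I (Subtype.val : U → M) x (ContinuousLinearMap.id ℝ EM) := by
  refine ⟨continuous_subtype_val.continuousAt, ?_⟩
  have h1 := TopologicalSpace.Opens.chartAt_subtype_val_symm_eventuallyEq (H := HM) U (x := x)
  have h2 : ContinuousAt I.symm ((extChartAt I x) x) := I.continuous_symm.continuousAt
  have h3 : I.symm ((extChartAt I x) x) = chartAt HM (x : M) x := by
    simp only [extChartAt_coe, Function.comp_apply, ModelWithCorners.left_inv]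
    rfl
  rw [ContinuousAt, h3] at h2
  have hA : ∀ᶠ z in 𝓝 ((extChartAt I x) x),
      (((extChartAt I x).symm z : U) : M) = (extChartAt I (x : M)).symm z := by
    filter_upwards [h2.eventually h1] with z hz
    simp only [Function.comp_apply, TopologicalSpace.Opens.chartAt_eq] at hz
    simp only [extChartAt_coe_symm, Function.comp_apply, TopologicalSpace.Opens.chartAt_eq]
    rw [← hz]
  have hid : HasFDerivWithinAt (writtenInExtChartAt I I x (Subtype.val : U → M))
      (ContinuousLinearMap.id ℝ EM) (range I) ((extChartAt I x) x) := by
    refine (hasFDerivWithinAt_id _ _).congr_of_eventuallyEq ?_ ?_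
    · filter_upwards [nhdsWithin_le_nhds hA,
        extChartAt_target_mem_nhdsWithin (I := I) (x : M)] with z hz hzt
      simp only [writtenInExtChartAt, Function.comp_apply, id_eq]
      rw [hz]
      exact (extChartAt I (x : M)).right_inv hzt
    · simp only [writtenInExtChartAt, Function.comp_apply, id_eq]
      rw [hA.self_of_nhds]
      exact (extChartAt I (x : M)).right_inv (mem_extChartAt_target (x : M))
  exact hid

/-- **`T_xU = T_xM`**: the restriction of `f : M → N` to an open subset `U` has at `x ∈ U` every
manifold derivative that `f` has at `x` (chain rule with the inclusion, whose differential is the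
identity).  refactor: the `mfderiv` form is the tree's
`Literature.Geometry.Lorentzian.mfderiv_comp_subtypeVal` (`HypersurfaceRestriction.lean`), and
the codomain-side companion is `Literature.Topology.FourManifolds.hasMFDerivAt_opens`.
[folklore] -/
theorem hasMFDerivAt_restrict_opens {f : M → N} (U : TopologicalSpace.Opens M) {x : U}
    {f' : EM →L[ℝ] EN} (hf : HasMFDerivAt I I' f (x : M) f') :
    HasMFDerivAt I I' (fun y : U => f y) x f' := by
  have h := hf.comp x (hasMFDerivAt_subtypeVal_opens (I := I) U x)
  have he : (f'.comp (ContinuousLinearMap.id ℝ EM) : EM →L[ℝ] EN) = f' := ContinuousLinearMap.comp_id f'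
  exact he ▸ h

/-- `mfderiv` form of `hasMFDerivAt_restrict_opens`. [folklore] -/
theorem mfderiv_restrict_opens {f : M → N} (U : TopologicalSpace.Opens M) {x : U}
    (hf : MDifferentiableAt I I' f (x : M)) :
    mfderiv I I' (fun y : U => f y) x = mfderiv I I' f (x : M) :=
  (hasMFDerivAt_restrict_opens U hf.hasMFDerivAt).mfderiv

end Opens

/-! ### The coordinate swap `x₁ ↔ x₂` of `ℝ⁴` -/

/-- The coordinate transposition `x₁ ↔ x₂` of `ℝ⁴`, `(u₀, u₁, u₂, u₃) ↦ (u₀, u₂, u₁, u₃)`, as a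
linear isometry (Mathlib's reindexing isometry `LinearIsometryEquiv.piLpCongrLeft` along
`Equiv.swap 1 2`, the tree's idiom for coordinate permutations). [folklore] -/
def swapOneTwo : E4 ≃ₗᵢ[ℝ] E4 :=
  LinearIsometryEquiv.piLpCongrLeft 2 ℝ ℝ (Equiv.swap (1 : Fin 4) 2)

/-- Coordinate `0` of `swapOneTwo u`. [folklore] -/
@[simp] theorem swapOneTwo_apply_zero (u : E4) : swapOneTwo u 0 = u 0 := by
  simp [swapOneTwo, LinearIsometryEquiv.piLpCongrLeft_apply, Equiv.swap_apply_def]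

/-- Coordinate `1` of `swapOneTwo u`. [folklore] -/
@[simp] theorem swapOneTwo_apply_one (u : E4) : swapOneTwo u 1 = u 2 := by
  simp [swapOneTwo, LinearIsometryEquiv.piLpCongrLeft_apply]

/-- Coordinate `2` of `swapOneTwo u`. [folklore] -/
@[simp] theorem swapOneTwo_apply_two (u : E4) : swapOneTwo u 2 = u 1 := by
  simp [swapOneTwo, LinearIsometryEquiv.piLpCongrLeft_apply]

/-- Coordinate `3` of `swapOneTwo u`. [folklore] -/
@[simp] theorem swapOneTwo_apply_three (u : E4) : swapOneTwo u 3 = u 3 := by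
  simp [swapOneTwo, LinearIsometryEquiv.piLpCongrLeft_apply, Equiv.swap_apply_def]

/-- The swap takes the attaching circle `S¹ × 0 = {(θ₀, θ₁, 0, 0)}` of Kosinski's model to the
Legendrian unknot `{(θ₀, 0, θ₁, 0)}`. [folklore] -/
theorem swapOneTwo_corePt (θ : 𝕊 1) : swapOneTwo (corePt θ) = realPlaneLin (θ : E2) := by
  ext i; fin_cases i <;> simp

/-- The swap takes the normal direction `e₂ = ∂/∂x_μ,₁` of the model circle to `e₁ = imagAxis`.
[folklore] -/
theorem swapOneTwo_single_two : swapOneTwo (EuclideanSpace.single (2 : Fin 4) (1 : ℝ)) = imagAxis := by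
  ext i; fin_cases i <;> simp [imagAxis]

/-! ### The model attaching map `h̄₀ : T → B⁴` -/

/-- **The model attaching map of a 2-handle on `B⁴` along the standard Legendrian unknot**:
Kosinski's tube `T = {x ∈ D⁴ | x_λ ≠ 0}` mapped into `B⁴` by the isometry `x₁ ↔ x₂`
(restricted to the closed ball, `closedBallCongr`, then to the open submanifold `T`), which
carries the model circle `S¹ × 0` onto `legendrianUnknot`. [cite: Kosinski1993, VI §6] -/
def unknotAttachingMap : HandleAttachingMap 3 2 (𝔻⁴) where
  toFun y := closedBallCongr swapOneTwo (y : 𝔻⁴)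
  isSmoothEmbedding :=
    (Manifold.IsSmoothEmbedding.of_opens (I := 𝓡∂ 4) (n := ∞) (handleTube 3 2)).diffeomorph_comp
      (closedBallCongr swapOneTwo)
  isOpen_range := by
    rw [show (range fun y : ↥(handleTube 3 2) => closedBallCongr swapOneTwo (y : 𝔻⁴)) =
        closedBallCongr swapOneTwo '' (handleTube 3 2 : Set (𝔻⁴)) by
      ext z
      constructor
      · rintro ⟨y, rfl⟩; exact ⟨y, y.2, rfl⟩
      · rintro ⟨w, hw, rfl⟩; exact ⟨⟨w, hw⟩, rfl⟩]
    exact (closedBallCongr swapOneTwo).toHomeomorph.isOpenMap _ (handleTube 3 2).isOpen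
  isBoundaryPoint y hy := by
    rw [isBoundaryPoint_iff_norm_eq_one, coe_closedBallCongr, LinearIsometryEquiv.norm_map]
    exact hy

/-- Unfolding `unknotAttachingMap`. [folklore] -/
theorem unknotAttachingMap_apply (y : ↥(handleTube 3 2)) :
    unknotAttachingMap.toFun y = closedBallCongr swapOneTwo (y : 𝔻⁴) := rfl

/-- **The attaching circle of the model attaching map is the standard Legendrian unknot.**
[folklore] -/
theorem attachingCircle_unknotAttachingMap :
    unknotAttachingMap.attachingCircle = legendrianUnknot := by
  funext θ
  apply Subtype.ext
  show swapOneTwo (corePt θ) = realPlaneLin (θ : E2)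
  exact swapOneTwo_corePt θ

/-- Pointwise form. [folklore] -/
theorem attachingCircle_unknotAttachingMap_apply (θ : 𝕊 1) :
    unknotAttachingMap.attachingCircle θ = legendrianUnknot θ := by
  rw [attachingCircle_unknotAttachingMap]

/-- The model attaching map sends the model circle point over `θ` to `legendrianUnknot θ`.
[folklore] -/
theorem unknotAttachingMap_coreTubePt (θ : 𝕊 1) :
    unknotAttachingMap.toFun (coreTubePt θ) = legendrianUnknot θ :=
  attachingCircle_unknotAttachingMap_apply θ

/-- **The differential of the model attaching map, read ambiently**: `Dι ∘ dh̄₀ = σ ∘ Dι`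
(`σ` the coordinate swap, `Dι = closedBallCoeDeriv`). [folklore] -/
theorem closedBallCoeDeriv_comp_mfderiv_unknotAttachingMap (y : ↥(handleTube 3 2)) :
    ((closedBallCoeDeriv (unknotAttachingMap.toFun y) : E4 →L[ℝ] E4).comp
        (mfderiv (𝓡∂ 4) (𝓡∂ 4) unknotAttachingMap.toFun y) : E4 →L[ℝ] E4) =
      (swapOneTwo.toContinuousLinearEquiv : E4 →L[ℝ] E4).comp
        (closedBallCoeDeriv (y : 𝔻⁴) : E4 →L[ℝ] E4) := by
  -- the map `y ↦ ι(h̄₀ y) = σ (ι y)` and its two derivative computations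
  have hfun : ((Subtype.val : 𝔻⁴ → E4) ∘ unknotAttachingMap.toFun) =
      fun y : ↥(handleTube 3 2) => swapOneTwo (((y : 𝔻⁴) : E4)) := rfl
  have h1 : HasMFDerivAt (𝓡∂ 4) 𝓘(ℝ, E4) (fun y : ↥(handleTube 3 2) => swapOneTwo (((y : 𝔻⁴) : E4))) y
      ((swapOneTwo.toContinuousLinearEquiv : E4 →L[ℝ] E4).comp
        (closedBallCoeDeriv (y : 𝔻⁴) : E4 →L[ℝ] E4)) := by
    have h := ((swapOneTwo.toContinuousLinearEquiv : E4 →L[ℝ] E4).hasFDerivAt.hasMFDerivAt).comp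
      (y : 𝔻⁴) (hasMFDerivAt_coe_closedBall (y : 𝔻⁴))
    exact hasMFDerivAt_restrict_opens (handleTube 3 2) (f := fun x : 𝔻⁴ => swapOneTwo (x : E4)) h
  have hd : MDifferentiableAt (𝓡∂ 4) (𝓡∂ 4) unknotAttachingMap.toFun y :=
    (unknotAttachingMap.isSmoothEmbedding.contMDiff y).mdifferentiableAt (by simp)
  have h2 : HasMFDerivAt (𝓡∂ 4) 𝓘(ℝ, E4) ((Subtype.val : 𝔻⁴ → E4) ∘ unknotAttachingMap.toFun) y
      ((closedBallCoeDeriv (unknotAttachingMap.toFun y) : E4 →L[ℝ] E4).comp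
        (mfderiv (𝓡∂ 4) (𝓡∂ 4) unknotAttachingMap.toFun y)) :=
    (hasMFDerivAt_coe_closedBall (unknotAttachingMap.toFun y)).comp y hd.hasMFDerivAt
  rw [hfun] at h2
  exact h2.mfderiv.symm.trans h1.mfderiv

/-- **The framing induced by the model handle is the Seifert framing of the Legendrian
unknot** (`dh̄₀(∂/∂x_μ,₁) = Dι⁻¹ (σ e₂) = Dι⁻¹ e₁`). [folklore] -/
theorem attachingFraming_unknotAttachingMap :
    unknotAttachingMap.attachingFraming = seifertFraming := by
  funext θ
  have hc := closedBallCoeDeriv_comp_mfderiv_unknotAttachingMap (coreTubePt θ)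
  have hv := congrArg (fun L : E4 →L[ℝ] E4 =>
    L ((closedBallCoeDeriv ((coreTubePt θ : ↥(handleTube 3 2)) : 𝔻⁴)).symm
      (EuclideanSpace.single (2 : Fin 4) (1 : ℝ)))) hc
  simp only [ContinuousLinearMap.comp_apply, ContinuousLinearEquiv.coe_coe,
    ContinuousLinearEquiv.apply_symm_apply, LinearIsometryEquiv.coe_toContinuousLinearEquiv] at hv
  -- `hv : Dι_{h̄₀ pt} (attachingFraming θ) = σ e₂ = imagAxis`; compare with the Seifert framing
  rw [unknotAttachingMap_coreTubePt, swapOneTwo_single_two] at hv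
  have hs : closedBallCoeDeriv (legendrianUnknot θ) (seifertFraming θ) = imagAxis :=
    closedBallCoeDeriv_seifertFraming θ
  have hinj := (closedBallCoeDeriv (legendrianUnknot θ)).injective
  apply hinj
  rw [hs]
  exact hv

/-- **The attaching circle of the model handle is a Legendrian knot** for the standard Stein
structure on `B⁴`. [cite: Gompf1998, §1] -/
theorem isLegendrianKnot_attachingCircle_unknotAttachingMap :
    IsLegendrianKnot steinStructureClosedBall.J unknotAttachingMap.attachingCircle := by
  rw [attachingCircle_unknotAttachingMap]; exact isLegendrianKnot_legendrianUnknot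

/-- The handle framing of the model attaching map is a framing of its attaching circle in `∂B⁴`.
[folklore] -/
theorem isKnotFraming_attachingFraming_unknotAttachingMap :
    IsKnotFraming unknotAttachingMap.attachingCircle unknotAttachingMap.attachingFraming := by
  rw [attachingCircle_unknotAttachingMap, attachingFraming_unknotAttachingMap]
  exact isKnotFraming_seifertFraming

/-- **The model handle has twisting number `+1`**: its framing is the Seifert (`0`-)framing of
the Legendrian unknot, `tb = -1`, so `f - tb = 1`.  In particular the framing hypothesis
"twisting `-1`" (framing `tb - 1 = -2`) of Eliashberg's theorem `Gompf1998_thm13_twoHandles`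
fails for it — as it must: `B⁴` with a 2-handle attached along the `0`-framed unknot is
`S² × D²`, which is not Stein. [cite: Gompf1998, §1] -/
theorem twisting_unknotAttachingMap :
    steinStructureClosedBall.twisting unknotAttachingMap.attachingCircle
      unknotAttachingMap.attachingFraming = 1 := by
  rw [attachingCircle_unknotAttachingMap, attachingFraming_unknotAttachingMap]
  exact twisting_legendrianUnknot_seifertFraming

/-- … hence defect `2` (so `AkbulutMatveyev1998_defectZero` does not apply either).
[cite: AkbulutMatveyev1998, §3] -/
theorem defect_unknotAttachingMap :
    steinStructureClosedBall.defect unknotAttachingMap.attachingCircle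
      unknotAttachingMap.attachingFraming = 2 := by
  rw [attachingCircle_unknotAttachingMap, attachingFraming_unknotAttachingMap]
  exact defect_legendrianUnknot_seifertFraming

end Literature.Geometry.Symplectic

end
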